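import Mathlib.Analysis.Normed.Group.Tannery
import Literature.MathematicalPhysics.QuantumFieldTheory.CircleHaarAngle
import Literature.MathematicalPhysics.QuantumFieldTheory.VillainKernelAnalysis
import Literature.Probability.LatticeModels.VillainMonotonicity
import Literature.Probability.LatticeModels.GinibreInequality
import HarnessLib

/-!
# Ginibre monotonicity of the Villain two-point function — proof of AHPS 2021, Cor. 11.4

This file discharges the named fact
`Literature.Probability.LatticeModels.AizenmanHarelPeledShapiro2021_villainTwoPoint_mono`
(`VillainMonotonicity.lean`): on a finite graph with Villain edge weights
`φ_κ(θ) = ∑_{n ∈ ℤ} e^{−(κ/2)(θ + 2πn)²}` (`villainKernel`), if `0 < κ_e ≤ κ'_e` on every edge then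
`⟨cos(θ_x − θ_y)⟩_κ ≤ ⟨cos(θ_x − θ_y)⟩_{κ'}` — M. Aizenman, M. Harel, R. Peled, J. Shapiro,
*Depinning in integer-restricted Gaussian fields and BKT phases of two-component spin models*,
arXiv:2110.09498, §11.3, Corollary 11.4 ("The spin-spin two-point function of the Villain model
is pointwise monotone in the coupling constants along each edge"). Theorems only; no definition
and no named fact is introduced.

## The proof, and how it deviates from the printed one

AHPS obtain Cor. 11.4 by combining the `XY` Ginibre inequality [Gin70] with their Thm 11.2 (the
Villain model is the `N → ∞` limit of `XY` models on the `N`-fold subdivided graph with `N`-fold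
couplings — a local central limit theorem for von Mises convolutions, only sketched in print).
Formalising that limit would require Bessel-function asymptotics absent from Mathlib. We prove
the corollary instead by running **Ginibre's duplicated-variables argument directly on the
Villain weights**, which needs no limit of models:

1. *Ginibre's frame* (`integral_mul_integral_le_of_dup_nonneg`, any compact abelian group in
   which every element is a square, Haar measure `μ`): by the duplicated-system expansion
   `integral_sub_mul_sub_mul` and the change of variables `θ = φψ`, `θ' = φψ⁻¹`
   (`integral_comp_dupHom`, both from the tree's Ginibre files),
   `2[(∫ fW')(∫ W) − (∫ fW)(∫ W')] = ∫∫ (f(φψ) − f(φψ⁻¹))(W'(φψ)W(φψ⁻¹) − W(φψ)W'(φψ⁻¹))`,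
   so monotonicity follows from positivity of the right-hand side.
2. *The model on the torus* `U(1)^V` with `μ = ⊗ haarProbability` and the transfer to the angle
   cube `[-π, π)^V` (`CircleHaar.integral_pi_haarProbability_circle`, `φ_β(arg e^{ir}) = φ_β(r)`):
   `villainTwoPoint s t κ x y = (∫ f W_κ dμ)/(∫ W_κ dμ)` with `f(u) = Re(u_x/u_y)`,
   `W_κ(u) = ∏_e φ_{κ_e}(arg(u_{t e}/u_{s e}))`.
3. *Positivity.* Pulled back to angles `(α, β)`, `f(φψ) − f(φψ⁻¹) = −2 sin(dα) sin(dβ)` and the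
   weight part is `∏_e A_e − ∏_e B_e` with `A_e = φ_{κ'}(a+b)φ_κ(a−b)`,
   `B_e = φ_κ(a+b)φ_{κ'}(a−b)` (`a = α_{te} − α_{se}`, `b = β_{te} − β_{se}`). **Key identity**
   (`hasSum_villainEdge_sinh`, `hasSum_villainEdge_cosh`): re-indexing the product of the two
   theta series by `(ε, j, l) ↦ (n, n') = (j + l + ε, j − l)` (`{0,1} × ℤ² ≃ ℤ²`) and writing
   `u = a + π(2j+ε)`, `v = b + π(2l+ε)`, `c = (κ+κ')/2`, `δ = κ' − κ ≥ 0`,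
   `B_e − A_e = ∑ e^{−cu²} e^{−cv²} 2 sinh(δuv)`,  `A_e + B_e = ∑ e^{−cu²} e^{−cv²} 2 cosh(δuv)`:
   Gaussian–`sinh/cosh` double series with non-negative Taylor coefficients. Truncating the
   lattice sum to `[-N, N]²` and the power series at `N` gives finite non-negative combinations of
   rank-one kernels `G(α)G(β)` (`IsPosKernel` of the tree; `isPosKernel_villainEdgeTrunc`),
   uniformly bounded (`abs_villainEdgeTrunc_le`, domination by `e^{−κ(u²+v²)}` as `c − δ/2 = κ`)
   and converging pointwise (Tannery's theorem, `tendsto_villainEdgeTrunc`). Such "bounded limits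
   of positive kernels" are closed under sums and products, so by induction over the edges
   (`B Y − A X = ½[(B−A)(Y+X) + (A+B)(Y−X)]`, `exists_isPosKernel_tendsto_prod_sub_prod`)
   `2 sin(dα) sin(dβ)(∏ B − ∏ A)` is one, and its integral over the angle cube is `≥ 0` by
   dominated convergence (`integral_nonneg_of_exists_isPosKernel_tendsto`).

The simple-graph hypotheses of the vendored statement are not used (the argument works for any
finite multigraph). Everything beyond the statement of Cor. 11.4 is elementary real analysis
([folklore] tags); the frame is Ginibre's [Ginibre1970].

## References

* [AizenmanHarelPeledShapiro2021] M. Aizenman, M. Harel, R. Peled, J. Shapiro, arXiv:2110.09498,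
  §11.3 Cor. 11.4 (with Thm 11.2 and §11, first paragraph; p. 25 of the arXiv version).
* [Ginibre1970] J. Ginibre, *General formulation of Griffiths' inequalities*, Comm. Math. Phys.
  16 (1970) 310–328 (main theorem; plane-rotator example).
-/

noncomputable section

open MeasureTheory Filter Finset Set
open scoped Topology BigOperators

namespace Literature.Probability.LatticeModels

open Literature.MathematicalPhysics.QuantumFieldTheory

/-! ### Truncated `cosh` series and a family version of positive kernels -/

/-- `∑_{n<N} x^{2n}/(2n)! → cosh x`. [folklore] -/
theorem tendsto_coshTrunc (x : ℝ) :
    Tendsto (fun N => ∑ n ∈ Finset.range N, x ^ (2 * n) / (Nat.factorial (2 * n) : ℝ)) atTop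
      (𝓝 (Real.cosh x)) :=
  (Real.hasSum_cosh x).tendsto_sum_nat

/-- `|∑_{n<N} x^{2n}/(2n)!| ≤ cosh M` for `|x| ≤ M`. [folklore] -/
theorem abs_coshTrunc_le {x M : ℝ} (hM : |x| ≤ M) (N : ℕ) :
    |∑ n ∈ Finset.range N, x ^ (2 * n) / (Nat.factorial (2 * n) : ℝ)| ≤ Real.cosh M := by
  calc |∑ n ∈ Finset.range N, x ^ (2 * n) / (Nat.factorial (2 * n) : ℝ)|
      ≤ ∑ n ∈ Finset.range N, |x ^ (2 * n) / (Nat.factorial (2 * n) : ℝ)| :=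
        Finset.abs_sum_le_sum_abs _ _
    _ ≤ ∑ n ∈ Finset.range N, M ^ (2 * n) / (Nat.factorial (2 * n) : ℝ) :=
        Finset.sum_le_sum fun n _ => by
          rw [abs_div, abs_pow, Nat.abs_cast]
          gcongr
    _ ≤ Real.cosh M :=
        sum_le_hasSum (Finset.range N) (fun n _ => by
          have : 0 ≤ M := (abs_nonneg x).trans hM
          positivity) (Real.hasSum_cosh M)

/-- The even truncation `∑_{n<N} k^{2n}/(2n)!` of a positive kernel is a positive kernel.
[folklore] -/
theorem IsPosKernel.comp_coshTrunc {Ω : Type*} [TopologicalSpace Ω] {k : Ω × Ω → ℝ}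
    (hk : IsPosKernel k) (N : ℕ) :
    IsPosKernel (fun p => ∑ n ∈ Finset.range N, (k p) ^ (2 * n) / (Nat.factorial (2 * n) : ℝ)) := by
  have : (fun p => ∑ n ∈ Finset.range N, (k p) ^ (2 * n) / (Nat.factorial (2 * n) : ℝ)) =
      ∑ n ∈ Finset.range N, fun p => ((Nat.factorial (2 * n) : ℕ) : ℝ)⁻¹ * (k ^ (2 * n)) p := by
    funext p; simp only [Finset.sum_apply, Pi.pow_apply, div_eq_inv_mul]
  rw [this]
  exact IsPosKernel.sum fun n _ => (hk.pow _).const_mul (inv_nonneg.2 (Nat.cast_nonneg _))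

/-- **Family version of positive kernels.** If `F(a, b) = ∑ᵢ cᵢ Gᵢ(a) Gᵢ(b)` is a positive kernel on
`ℝ` and `(g_a)_{a ∈ s}` is a finite family of continuous real functions on `X`, then
`(x, y) ↦ ∑_{a, b ∈ s} F(g_a(x), g_b(y)) = ∑ᵢ cᵢ (∑_a Gᵢ ∘ g_a)(x) (∑_b Gᵢ ∘ g_b)(y)` is a
positive kernel on `X`. [folklore] -/
theorem IsPosKernel.sum_sum_comp {F : ℝ × ℝ → ℝ} (hF : IsPosKernel F) {X : Type*}
    [TopologicalSpace X] {σ : Type*} (s : Finset σ) {g : σ → X → ℝ} (hg : ∀ a, Continuous (g a)) :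
    IsPosKernel (fun p : X × X => ∑ a ∈ s, ∑ b ∈ s, F (g a p.1, g b p.2)) := by
  obtain ⟨K, _, c, G, hc, hG, rfl⟩ := hF
  refine ⟨K, inferInstance, c, fun k x => ∑ a ∈ s, G k (g a x), hc, fun k => ?_,
    funext fun p => ?_⟩
  · exact continuous_finsetSum _ fun a _ => (hG k).comp (hg a)
  · calc ∑ a ∈ s, ∑ b ∈ s, ∑ i, c i * (G i (g a p.1) * G i (g b p.2))
          = ∑ a ∈ s, ∑ i, ∑ b ∈ s, c i * (G i (g a p.1) * G i (g b p.2)) :=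
            Finset.sum_congr rfl fun a _ => Finset.sum_comm
      _ = ∑ i, ∑ a ∈ s, ∑ b ∈ s, c i * (G i (g a p.1) * G i (g b p.2)) := Finset.sum_comm
      _ = ∑ i, c i * ((∑ a ∈ s, G i (g a p.1)) * ∑ b ∈ s, G i (g b p.2)) := by
            refine Finset.sum_congr rfl fun i _ => ?_
            rw [Finset.sum_mul_sum, Finset.mul_sum]
            refine Finset.sum_congr rfl fun a _ => ?_
            rw [Finset.mul_sum]

/-! ### The Villain kernel on the circle -/

/-- The Villain kernel is bounded on `ℝ` (`β > 0`): it is a continuous function of `e^{ir}` on the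
compact circle. [folklore] -/
theorem exists_villainKernel_le {β : ℝ} (hβ : 0 < β) : ∃ M : ℝ, ∀ r, villainKernel β r ≤ M := by
  obtain ⟨C, hC⟩ := exists_bound_of_continuous_circle (continuous_villainKernel_arg hβ)
  refine ⟨C, fun r => ?_⟩
  -- `φ_β(arg e^{ir}) = φ_β(r)` (`arg e^{ir} = r mod 2π`, periodicity; cf.
  -- `VillainAngle.villainKernel_arg_exp` in the `U(1)` gauge-theory files, not imported here)
  have h : villainKernel β (Complex.arg (Circle.exp r : ℂ)) = villainKernel β r := by
    rw [Circle.coe_exp, Complex.arg_exp_mul_I, toIocMod]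
    exact (show Function.Periodic (villainKernel β) (2 * Real.pi) from
      villainKernel_add_two_pi β).sub_zsmul_eq _
  rw [← h]
  exact (le_abs_self _).trans (hC _)

/-! ### The product of two Villain kernels as a re-indexed double Gaussian series -/

/-- **Re-indexing the product of two theta series.** For `κ₁, κ₂ > 0`,
`φ_{κ₁}(r + r') φ_{κ₂}(r − r') = ∑_{n,n' ∈ ℤ} e^{−(κ₁/2)(r+r'+2πn)²} e^{−(κ₂/2)(r−r'+2πn')²}`, and the
bijection `(ε, j, l) ↦ (n, n') = (j + l + ε, j − l)` of `{0,1} × ℤ × ℤ` onto `ℤ × ℤ` (`n + n'` and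
`n − n'` have the parity of `ε`) rewrites it in the variables `u = r + π(2j + ε)`,
`v = r' + π(2l + ε)`, for which `u + v = r + r' + 2πn` and `u − v = r − r' + 2πn'`. [folklore] -/
theorem hasSum_villainKernel_mul_villainKernel {κ₁ κ₂ : ℝ} (h₁ : 0 < κ₁) (h₂ : 0 < κ₂)
    (r r' : ℝ) :
    HasSum (fun q : Fin 2 × ℤ × ℤ =>
      Real.exp (-(κ₁ / 2) * ((r + Real.pi * (2 * q.2.1 + q.1.val)) +
        (r' + Real.pi * (2 * q.2.2 + q.1.val))) ^ 2) *
      Real.exp (-(κ₂ / 2) * ((r + Real.pi * (2 * q.2.1 + q.1.val)) -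
        (r' + Real.pi * (2 * q.2.2 + q.1.val))) ^ 2))
      (villainKernel κ₁ (r + r') * villainKernel κ₂ (r - r')) := by
  have hf := (summable_villainKernel_term h₁ (r + r')).hasSum
  have hg := (summable_villainKernel_term h₂ (r - r')).hasSum
  have hfg : HasSum (fun p : ℤ × ℤ => Real.exp (-(κ₁ / 2) * (r + r' + 2 * Real.pi * p.1) ^ 2) *
      Real.exp (-(κ₂ / 2) * (r - r' + 2 * Real.pi * p.2) ^ 2))
      (villainKernel κ₁ (r + r') * villainKernel κ₂ (r - r')) :=
    hf.mul hg (hf.summable.mul_of_nonneg hg.summable (fun _ => (Real.exp_pos _).le)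
      fun _ => (Real.exp_pos _).le)
  let e : Fin 2 × ℤ × ℤ ≃ ℤ × ℤ :=
    { toFun := fun q => (q.2.1 + q.2.2 + q.1.val, q.2.1 - q.2.2)
      invFun := fun p => (⟨((p.1 + p.2) % 2).toNat, by omega⟩, (p.1 + p.2) / 2, (p.1 - p.2) / 2)
      left_inv := by
        rintro ⟨⟨ε, hε⟩, j, l⟩
        refine Prod.ext (Fin.ext ?_) (Prod.ext ?_ ?_) <;> simp only <;> omega
      right_inv := by
        rintro ⟨n, n'⟩
        refine Prod.ext ?_ ?_ <;> simp only <;> omega }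
  have := (e.hasSum_iff).2 hfg
  convert this using 2 with q
  simp only [Function.comp_apply, e, Equiv.coe_fn_mk]
  push_cast
  congr 1 <;> congr 1 <;> congr 1 <;> ring

/-- **The antisymmetrised product of two Villain kernels is a Gaussian–`sinh` double series**:
for `0 < κ ≤ κ'`, with `c = (κ+κ')/2`, `δ = κ' − κ ≥ 0`, `u = r + π(2j+ε)`, `v = r' + π(2l+ε)`,
`φ_κ(r+r') φ_κ'(r−r') − φ_κ'(r+r') φ_κ(r−r') = ∑_{ε,j,l} e^{−cu²} e^{−cv²} · 2 sinh(δuv)`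
(`(κ/2)(u+v)² + (κ'/2)(u−v)² = c(u²+v²) − δuv`). [folklore] -/
theorem hasSum_villainEdge_sinh {κ κ' : ℝ} (hκ : 0 < κ) (hκκ' : κ ≤ κ') (r r' : ℝ) :
    HasSum (fun q : Fin 2 × ℤ × ℤ =>
      Real.exp (-((κ + κ') / 2) * (r + Real.pi * (2 * q.2.1 + q.1.val)) ^ 2) *
      Real.exp (-((κ + κ') / 2) * (r' + Real.pi * (2 * q.2.2 + q.1.val)) ^ 2) *
      (2 * Real.sinh ((κ' - κ) *
        ((r + Real.pi * (2 * q.2.1 + q.1.val)) * (r' + Real.pi * (2 * q.2.2 + q.1.val))))))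
      (villainKernel κ (r + r') * villainKernel κ' (r - r') -
        villainKernel κ' (r + r') * villainKernel κ (r - r')) := by
  have hκ' : 0 < κ' := hκ.trans_le hκκ'
  have hB := hasSum_villainKernel_mul_villainKernel hκ hκ' r r'
  have hA := hasSum_villainKernel_mul_villainKernel hκ' hκ r r'
  have key : ∀ u v : ℝ,
      Real.exp (-((κ + κ') / 2) * u ^ 2) * Real.exp (-((κ + κ') / 2) * v ^ 2) *
          (2 * Real.sinh ((κ' - κ) * (u * v))) =
        Real.exp (-(κ / 2) * (u + v) ^ 2) * Real.exp (-(κ' / 2) * (u - v) ^ 2) -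
          Real.exp (-(κ' / 2) * (u + v) ^ 2) * Real.exp (-(κ / 2) * (u - v) ^ 2) := by
    intro u v
    have e1 : Real.exp (-(κ / 2) * (u + v) ^ 2) * Real.exp (-(κ' / 2) * (u - v) ^ 2) =
        Real.exp (-((κ + κ') / 2) * u ^ 2) * Real.exp (-((κ + κ') / 2) * v ^ 2) *
          Real.exp ((κ' - κ) * (u * v)) := by
      rw [← Real.exp_add, ← Real.exp_add, ← Real.exp_add]; congr 1; ring
    have e2 : Real.exp (-(κ' / 2) * (u + v) ^ 2) * Real.exp (-(κ / 2) * (u - v) ^ 2) =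
        Real.exp (-((κ + κ') / 2) * u ^ 2) * Real.exp (-((κ + κ') / 2) * v ^ 2) *
          Real.exp (-((κ' - κ) * (u * v))) := by
      rw [← Real.exp_add, ← Real.exp_add, ← Real.exp_add]; congr 1; ring
    rw [e1, e2, Real.sinh_eq]
    ring
  simp only [key]
  exact hB.sub hA

/-- The symmetrised product: `φ_κ'(r+r') φ_κ(r−r') + φ_κ(r+r') φ_κ'(r−r') =
∑_{ε,j,l} e^{−cu²} e^{−cv²} · 2 cosh(δuv)`. [folklore] -/
theorem hasSum_villainEdge_cosh {κ κ' : ℝ} (hκ : 0 < κ) (hκκ' : κ ≤ κ') (r r' : ℝ) :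
    HasSum (fun q : Fin 2 × ℤ × ℤ =>
      Real.exp (-((κ + κ') / 2) * (r + Real.pi * (2 * q.2.1 + q.1.val)) ^ 2) *
      Real.exp (-((κ + κ') / 2) * (r' + Real.pi * (2 * q.2.2 + q.1.val)) ^ 2) *
      (2 * Real.cosh ((κ' - κ) *
        ((r + Real.pi * (2 * q.2.1 + q.1.val)) * (r' + Real.pi * (2 * q.2.2 + q.1.val))))))
      (villainKernel κ' (r + r') * villainKernel κ (r - r') +
        villainKernel κ (r + r') * villainKernel κ' (r - r')) := by
  have hκ' : 0 < κ' := hκ.trans_le hκκ'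
  have hB := hasSum_villainKernel_mul_villainKernel hκ hκ' r r'
  have hA := hasSum_villainKernel_mul_villainKernel hκ' hκ r r'
  have key : ∀ u v : ℝ,
      Real.exp (-((κ + κ') / 2) * u ^ 2) * Real.exp (-((κ + κ') / 2) * v ^ 2) *
          (2 * Real.cosh ((κ' - κ) * (u * v))) =
        Real.exp (-(κ' / 2) * (u + v) ^ 2) * Real.exp (-(κ / 2) * (u - v) ^ 2) +
          Real.exp (-(κ / 2) * (u + v) ^ 2) * Real.exp (-(κ' / 2) * (u - v) ^ 2) := by
    intro u v
    have e1 : Real.exp (-(κ / 2) * (u + v) ^ 2) * Real.exp (-(κ' / 2) * (u - v) ^ 2) =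
        Real.exp (-((κ + κ') / 2) * u ^ 2) * Real.exp (-((κ + κ') / 2) * v ^ 2) *
          Real.exp ((κ' - κ) * (u * v)) := by
      rw [← Real.exp_add, ← Real.exp_add, ← Real.exp_add]; congr 1; ring
    have e2 : Real.exp (-(κ' / 2) * (u + v) ^ 2) * Real.exp (-(κ / 2) * (u - v) ^ 2) =
        Real.exp (-((κ + κ') / 2) * u ^ 2) * Real.exp (-((κ + κ') / 2) * v ^ 2) *
          Real.exp (-((κ' - κ) * (u * v))) := by
      rw [← Real.exp_add, ← Real.exp_add, ← Real.exp_add]; congr 1; ring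
    rw [e1, e2, Real.cosh_eq]
    ring
  simp only [key]
  exact hA.add hB

/-- The dominating family `e^{−κu²} e^{−κv²}` sums to `φ_κ(r+r') φ_κ(r−r')`
(`(u+v)² + (u−v)² = 2u² + 2v²`). [folklore] -/
theorem hasSum_villainEdge_bound {κ : ℝ} (hκ : 0 < κ) (r r' : ℝ) :
    HasSum (fun q : Fin 2 × ℤ × ℤ =>
      Real.exp (-κ * (r + Real.pi * (2 * q.2.1 + q.1.val)) ^ 2) *
      Real.exp (-κ * (r' + Real.pi * (2 * q.2.2 + q.1.val)) ^ 2))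
      (villainKernel κ (r + r') * villainKernel κ (r - r')) := by
  convert hasSum_villainKernel_mul_villainKernel hκ hκ r r' using 2 with q
  rw [← Real.exp_add, ← Real.exp_add]
  congr 1
  ring


/-! ### Truncated edge kernels: domination, convergence (Tannery), positivity -/

/-- Pointwise domination of a truncated edge term: if `|T_N(x)| ≤ C e^{|x|}` then, with
`c = (κ+κ')/2`, `δ = κ' − κ ≥ 0`, `e^{−cu²} e^{−cv²} |T_N(δuv)| ≤ C e^{−κu²} e^{−κv²}`
(`δ|uv| ≤ (δ/2)(u² + v²)` and `c − δ/2 = κ`). [folklore] -/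
theorem abs_villainEdgeTerm_le {κ κ' : ℝ} (hκκ' : κ ≤ κ') {T : ℕ → ℝ → ℝ} {C : ℝ}
    (hT : ∀ N x, |T N x| ≤ C * Real.exp |x|) (u v : ℝ) (N : ℕ) :
    |Real.exp (-((κ + κ') / 2) * u ^ 2) * Real.exp (-((κ + κ') / 2) * v ^ 2) *
        T N ((κ' - κ) * (u * v))| ≤ C * (Real.exp (-κ * u ^ 2) * Real.exp (-κ * v ^ 2)) := by
  have hC : 0 ≤ C := by
    have h := hT 0 0
    rw [abs_zero, Real.exp_zero, mul_one] at h
    exact (abs_nonneg _).trans h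
  rw [abs_mul, abs_mul, abs_of_pos (Real.exp_pos _), abs_of_pos (Real.exp_pos _)]
  have h1 := hT N ((κ' - κ) * (u * v))
  have h2 : |(κ' - κ) * (u * v)| ≤ (κ' - κ) / 2 * (u ^ 2 + v ^ 2) := by
    rw [abs_mul, abs_of_nonneg (sub_nonneg.2 hκκ'), abs_mul]
    have := two_mul_le_add_sq |u| |v|
    rw [sq_abs, sq_abs] at this
    nlinarith [sub_nonneg.2 hκκ', abs_nonneg u, abs_nonneg v]
  have h3 : Real.exp |(κ' - κ) * (u * v)| ≤ Real.exp ((κ' - κ) / 2 * (u ^ 2 + v ^ 2)) :=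
    Real.exp_le_exp.2 h2
  calc Real.exp (-((κ + κ') / 2) * u ^ 2) * Real.exp (-((κ + κ') / 2) * v ^ 2) *
        |T N ((κ' - κ) * (u * v))|
      ≤ Real.exp (-((κ + κ') / 2) * u ^ 2) * Real.exp (-((κ + κ') / 2) * v ^ 2) *
        (C * Real.exp ((κ' - κ) / 2 * (u ^ 2 + v ^ 2))) := by
        gcongr
        exact h1.trans (mul_le_mul_of_nonneg_left h3 hC)
    _ = C * Real.exp (-((κ + κ') / 2) * u ^ 2 + -((κ + κ') / 2) * v ^ 2 +
        (κ' - κ) / 2 * (u ^ 2 + v ^ 2)) := by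
        rw [Real.exp_add, Real.exp_add]; ring
    _ = C * (Real.exp (-κ * u ^ 2) * Real.exp (-κ * v ^ 2)) := by
        rw [← Real.exp_add]; congr 2; ring

/-- **Uniform bound for the truncated edge kernels**: the finite sums over the box
`{0,1} × [-N,N]²` are bounded by `C φ_κ(r+r') φ_κ(r−r')`. [folklore] -/
theorem abs_villainEdgeTrunc_le {κ κ' : ℝ} (hκ : 0 < κ) (hκκ' : κ ≤ κ') {T : ℕ → ℝ → ℝ}
    {C : ℝ} (hT : ∀ N x, |T N x| ≤ C * Real.exp |x|) (r r' : ℝ) (N : ℕ) :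
    |∑ q ∈ (Finset.univ : Finset (Fin 2)) ×ˢ (Finset.Icc (-(N : ℤ)) N ×ˢ Finset.Icc (-(N : ℤ)) N),
      Real.exp (-((κ + κ') / 2) * (r + Real.pi * (2 * q.2.1 + q.1.val)) ^ 2) *
      Real.exp (-((κ + κ') / 2) * (r' + Real.pi * (2 * q.2.2 + q.1.val)) ^ 2) *
      T N ((κ' - κ) *
        ((r + Real.pi * (2 * q.2.1 + q.1.val)) * (r' + Real.pi * (2 * q.2.2 + q.1.val))))| ≤
      C * (villainKernel κ (r + r') * villainKernel κ (r - r')) := by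
  have hb := hasSum_villainEdge_bound hκ r r'
  refine (Finset.abs_sum_le_sum_abs _ _).trans ?_
  refine (Finset.sum_le_sum fun q _ => abs_villainEdgeTerm_le hκκ' hT _ _ N).trans ?_
  rw [← hb.tsum_eq, ← tsum_mul_left]
  refine (hb.summable.mul_left C).sum_le_tsum _ fun q _ => ?_
  have hC : 0 ≤ C := by
    have h := hT 0 0
    rw [abs_zero, Real.exp_zero, mul_one] at h
    exact (abs_nonneg _).trans h
  positivity

/-- **Convergence of the truncated edge kernels (Tannery's theorem).** If `|T_N(x)| ≤ C e^{|x|}`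
and `T_N(x) → T(x)` pointwise, the finite sums over the growing boxes `{0,1} × [-N,N]²` of
`e^{−cu²} e^{−cv²} T_N(δuv)` converge to the full series of `e^{−cu²} e^{−cv²} T(δuv)`
(dominated by the summable `C e^{−κu²} e^{−κv²}`). [folklore] -/
theorem tendsto_villainEdgeTrunc {κ κ' : ℝ} (hκ : 0 < κ) (hκκ' : κ ≤ κ') {T : ℕ → ℝ → ℝ}
    {Tlim : ℝ → ℝ} {C : ℝ} (hT : ∀ N x, |T N x| ≤ C * Real.exp |x|)
    (hlim : ∀ x, Tendsto (fun N => T N x) atTop (𝓝 (Tlim x))) (r r' : ℝ) :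
    Tendsto (fun N : ℕ => ∑ q ∈ (Finset.univ : Finset (Fin 2)) ×ˢ
        (Finset.Icc (-(N : ℤ)) N ×ˢ Finset.Icc (-(N : ℤ)) N),
      Real.exp (-((κ + κ') / 2) * (r + Real.pi * (2 * q.2.1 + q.1.val)) ^ 2) *
      Real.exp (-((κ + κ') / 2) * (r' + Real.pi * (2 * q.2.2 + q.1.val)) ^ 2) *
      T N ((κ' - κ) *
        ((r + Real.pi * (2 * q.2.1 + q.1.val)) * (r' + Real.pi * (2 * q.2.2 + q.1.val)))))
      atTop (𝓝 (∑' q : Fin 2 × ℤ × ℤ,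
      Real.exp (-((κ + κ') / 2) * (r + Real.pi * (2 * q.2.1 + q.1.val)) ^ 2) *
      Real.exp (-((κ + κ') / 2) * (r' + Real.pi * (2 * q.2.2 + q.1.val)) ^ 2) *
      Tlim ((κ' - κ) *
        ((r + Real.pi * (2 * q.2.1 + q.1.val)) * (r' + Real.pi * (2 * q.2.2 + q.1.val)))))) := by
  refine (tendsto_tsum_of_dominated_convergence
    (bound := fun q : Fin 2 × ℤ × ℤ => C * (Real.exp (-κ * (r + Real.pi * (2 * q.2.1 + q.1.val)) ^ 2) *
      Real.exp (-κ * (r' + Real.pi * (2 * q.2.2 + q.1.val)) ^ 2)))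
    ((hasSum_villainEdge_bound hκ r r').summable.mul_left C) (fun q => ?_)
    (Filter.Eventually.of_forall fun N q => ?_)).congr fun N => (sum_eq_tsum_indicator _ _).symm
  · obtain ⟨ε, j, l⟩ := q
    have hmem : ∀ᶠ N : ℕ in atTop, (ε, j, l) ∈ (Finset.univ : Finset (Fin 2)) ×ˢ
        (Finset.Icc (-(N : ℤ)) N ×ˢ Finset.Icc (-(N : ℤ)) N) := by
      refine (eventually_ge_atTop (j.natAbs + l.natAbs)).mono fun N hN => ?_
      simp only [Finset.mem_product, Finset.mem_univ, Finset.mem_Icc, true_and]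
      omega
    refine (((hlim _).const_mul _).congr' (hmem.mono fun N hN => ?_))
    simp only [Set.indicator_of_mem (Finset.mem_coe.2 hN)]
  · refine (norm_indicator_le_norm_self _ _).trans ?_
    rw [Real.norm_eq_abs]
    exact abs_villainEdgeTerm_le hκκ' hT _ _ N

/-- **The truncated edge kernels are positive kernels.** For a continuous `d : X → ℝ`, a
positive kernel `(a, b) ↦ T(δab)` on `ℝ`, and the finite family of shifts
`x ↦ d(x) + π(2m + ε)`, the kernel `∑_{ε} ∑_{j,l ∈ [-N,N]} e^{−c u_j²} e^{−c v_l²} T(δ u_j v_l)`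
(`u_j = d(x) + π(2j+ε)`, `v_l = d(y) + π(2l+ε)`) is a positive kernel on `X`. [folklore] -/
theorem isPosKernel_villainEdgeTrunc {X : Type*} [TopologicalSpace X] {d : X → ℝ}
    (hd : Continuous d) (c δ : ℝ) {T : ℝ → ℝ}
    (hT : IsPosKernel (fun p : ℝ × ℝ => T (δ * (p.1 * p.2)))) (N : ℕ) :
    IsPosKernel (fun p : X × X => ∑ q ∈ (Finset.univ : Finset (Fin 2)) ×ˢ
        (Finset.Icc (-(N : ℤ)) N ×ˢ Finset.Icc (-(N : ℤ)) N),
      Real.exp (-c * (d p.1 + Real.pi * (2 * q.2.1 + q.1.val)) ^ 2) *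
      Real.exp (-c * (d p.2 + Real.pi * (2 * q.2.2 + q.1.val)) ^ 2) *
      T (δ * ((d p.1 + Real.pi * (2 * q.2.1 + q.1.val)) * (d p.2 + Real.pi * (2 * q.2.2 + q.1.val))))) := by
  have hF : IsPosKernel (fun p : ℝ × ℝ =>
      Real.exp (-c * p.1 ^ 2) * Real.exp (-c * p.2 ^ 2) * T (δ * (p.1 * p.2))) :=
    (isPosKernel_mul_self (by fun_prop : Continuous fun a : ℝ => Real.exp (-c * a ^ 2))).mul hT
  have heq : (fun p : X × X => ∑ q ∈ (Finset.univ : Finset (Fin 2)) ×ˢ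
        (Finset.Icc (-(N : ℤ)) N ×ˢ Finset.Icc (-(N : ℤ)) N),
      Real.exp (-c * (d p.1 + Real.pi * (2 * q.2.1 + q.1.val)) ^ 2) *
      Real.exp (-c * (d p.2 + Real.pi * (2 * q.2.2 + q.1.val)) ^ 2) *
      T (δ * ((d p.1 + Real.pi * (2 * q.2.1 + q.1.val)) *
        (d p.2 + Real.pi * (2 * q.2.2 + q.1.val))))) =
      ∑ ε : Fin 2, fun p : X × X => ∑ j ∈ Finset.Icc (-(N : ℤ)) N, ∑ l ∈ Finset.Icc (-(N : ℤ)) N,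
        (fun p' : ℝ × ℝ => Real.exp (-c * p'.1 ^ 2) * Real.exp (-c * p'.2 ^ 2) *
          T (δ * (p'.1 * p'.2)))
          (d p.1 + Real.pi * (2 * j + ε.val), d p.2 + Real.pi * (2 * l + ε.val)) := by
    funext p
    rw [Finset.sum_apply, Finset.sum_product]
    refine Finset.sum_congr rfl fun ε _ => ?_
    rw [Finset.sum_product]
  rw [heq]
  exact IsPosKernel.sum fun ε _ => hF.sum_sum_comp (Finset.Icc (-(N : ℤ)) N)
    (g := fun j x => d x + Real.pi * (2 * j + ε.val)) fun j => by fun_prop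

/-- `|2 sinhTrunc N x| ≤ e^{|x|}`. [folklore] -/
theorem abs_two_mul_sinhTrunc_le (N : ℕ) (x : ℝ) : |2 * sinhTrunc N x| ≤ 1 * Real.exp |x| := by
  rw [abs_mul, abs_two, one_mul]
  have h := abs_sinhTrunc_le (le_refl |x|) N
  have : 2 * Real.sinh |x| ≤ Real.exp |x| := by
    rw [Real.sinh_eq]; have := Real.exp_pos (-|x|); linarith
  linarith

/-- `|2 coshTrunc N x| ≤ 2 e^{|x|}`. [folklore] -/
theorem abs_two_mul_coshTrunc_le (N : ℕ) (x : ℝ) :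
    |2 * ∑ n ∈ Finset.range N, x ^ (2 * n) / (Nat.factorial (2 * n) : ℝ)| ≤ 2 * Real.exp |x| := by
  rw [abs_mul, abs_two]
  have h := abs_coshTrunc_le (le_refl |x|) N
  have : Real.cosh |x| ≤ Real.exp |x| := by
    rw [Real.cosh_eq]; have := Real.exp_pos (-|x|)
    have : Real.exp (-|x|) ≤ Real.exp |x| := Real.exp_le_exp.2 (by linarith [abs_nonneg x])
    linarith
  linarith

/-- **The antisymmetrised edge kernel is a bounded limit of positive kernels**: for continuous
`d : X → ℝ` and `0 < κ ≤ κ'`, the kernel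
`(x, y) ↦ φ_κ(d x + d y) φ_κ'(d x − d y) − φ_κ'(d x + d y) φ_κ(d x − d y)` is the pointwise limit
of the uniformly bounded positive kernels obtained by truncating the Gaussian–`sinh` series.
[folklore] -/
theorem exists_isPosKernel_tendsto_villainEdge_sub {X : Type*} [TopologicalSpace X] {d : X → ℝ}
    (hd : Continuous d) {κ κ' : ℝ} (hκ : 0 < κ) (hκκ' : κ ≤ κ') :
    ∃ (k : ℕ → X × X → ℝ) (M : ℝ), (∀ N, IsPosKernel (k N)) ∧ (∀ N p, |k N p| ≤ M) ∧
      ∀ p, Tendsto (fun N => k N p) atTop (𝓝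
        (villainKernel κ (d p.1 + d p.2) * villainKernel κ' (d p.1 - d p.2) -
          villainKernel κ' (d p.1 + d p.2) * villainKernel κ (d p.1 - d p.2))) := by
  obtain ⟨Mκ, hMκ⟩ := exists_villainKernel_le hκ
  have hT : ∀ (N : ℕ) (x : ℝ), |(fun N x => 2 * sinhTrunc N x) N x| ≤ 1 * Real.exp |x| :=
    abs_two_mul_sinhTrunc_le
  refine ⟨fun N p => ∑ q ∈ (Finset.univ : Finset (Fin 2)) ×ˢ
        (Finset.Icc (-(N : ℤ)) N ×ˢ Finset.Icc (-(N : ℤ)) N),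
      Real.exp (-((κ + κ') / 2) * (d p.1 + Real.pi * (2 * q.2.1 + q.1.val)) ^ 2) *
      Real.exp (-((κ + κ') / 2) * (d p.2 + Real.pi * (2 * q.2.2 + q.1.val)) ^ 2) *
      (2 * sinhTrunc N ((κ' - κ) *
        ((d p.1 + Real.pi * (2 * q.2.1 + q.1.val)) * (d p.2 + Real.pi * (2 * q.2.2 + q.1.val))))),
    1 * (Mκ * Mκ), fun N => ?_, fun N p => ?_, fun p => ?_⟩
  · have h0 : IsPosKernel (fun p : ℝ × ℝ => (κ' - κ) * (p.1 * p.2)) :=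
      (isPosKernel_mul_self continuous_id).const_mul (sub_nonneg.2 hκκ')
    exact isPosKernel_villainEdgeTrunc hd _ _ (T := fun x => 2 * sinhTrunc N x)
      ((h0.comp_sinhTrunc N).const_mul zero_le_two) N
  · refine (abs_villainEdgeTrunc_le hκ hκκ' hT (d p.1) (d p.2) N).trans ?_
    refine mul_le_mul_of_nonneg_left ?_ (by norm_num)
    exact mul_le_mul (hMκ _) (hMκ _) (villainKernel_pos hκ (d p.1 - d p.2)).le
      ((villainKernel_pos hκ 0).le.trans (hMκ 0))
  · have h := tendsto_villainEdgeTrunc hκ hκκ' hT (Tlim := fun x => 2 * Real.sinh x)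
      (fun x => (tendsto_sinhTrunc x).const_mul 2) (d p.1) (d p.2)
    rwa [(hasSum_villainEdge_sinh hκ hκκ' (d p.1) (d p.2)).tsum_eq] at h

/-- **The symmetrised edge kernel is a bounded limit of positive kernels**:
`(x, y) ↦ φ_κ'(d x + d y) φ_κ(d x − d y) + φ_κ(d x + d y) φ_κ'(d x − d y)` (Gaussian–`cosh`
series). [folklore] -/
theorem exists_isPosKernel_tendsto_villainEdge_add {X : Type*} [TopologicalSpace X] {d : X → ℝ}
    (hd : Continuous d) {κ κ' : ℝ} (hκ : 0 < κ) (hκκ' : κ ≤ κ') :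
    ∃ (k : ℕ → X × X → ℝ) (M : ℝ), (∀ N, IsPosKernel (k N)) ∧ (∀ N p, |k N p| ≤ M) ∧
      ∀ p, Tendsto (fun N => k N p) atTop (𝓝
        (villainKernel κ' (d p.1 + d p.2) * villainKernel κ (d p.1 - d p.2) +
          villainKernel κ (d p.1 + d p.2) * villainKernel κ' (d p.1 - d p.2))) := by
  obtain ⟨Mκ, hMκ⟩ := exists_villainKernel_le hκ
  have hT : ∀ (N : ℕ) (x : ℝ), |(fun N x => 2 * ∑ n ∈ Finset.range N,
      x ^ (2 * n) / (Nat.factorial (2 * n) : ℝ)) N x| ≤ 2 * Real.exp |x| :=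
    abs_two_mul_coshTrunc_le
  refine ⟨fun N p => ∑ q ∈ (Finset.univ : Finset (Fin 2)) ×ˢ
        (Finset.Icc (-(N : ℤ)) N ×ˢ Finset.Icc (-(N : ℤ)) N),
      Real.exp (-((κ + κ') / 2) * (d p.1 + Real.pi * (2 * q.2.1 + q.1.val)) ^ 2) *
      Real.exp (-((κ + κ') / 2) * (d p.2 + Real.pi * (2 * q.2.2 + q.1.val)) ^ 2) *
      (2 * ∑ n ∈ Finset.range N, ((κ' - κ) *
        ((d p.1 + Real.pi * (2 * q.2.1 + q.1.val)) * (d p.2 + Real.pi * (2 * q.2.2 + q.1.val)))) ^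
          (2 * n) / (Nat.factorial (2 * n) : ℝ)),
    2 * (Mκ * Mκ), fun N => ?_, fun N p => ?_, fun p => ?_⟩
  · have h0 : IsPosKernel (fun p : ℝ × ℝ => (κ' - κ) * (p.1 * p.2)) :=
      (isPosKernel_mul_self continuous_id).const_mul (sub_nonneg.2 hκκ')
    exact isPosKernel_villainEdgeTrunc hd _ _
      (T := fun x => 2 * ∑ n ∈ Finset.range N, x ^ (2 * n) / (Nat.factorial (2 * n) : ℝ))
      ((h0.comp_coshTrunc N).const_mul zero_le_two) N
  · refine (abs_villainEdgeTrunc_le hκ hκκ' hT (d p.1) (d p.2) N).trans ?_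
    refine mul_le_mul_of_nonneg_left ?_ (by norm_num)
    exact mul_le_mul (hMκ _) (hMκ _) (villainKernel_pos hκ (d p.1 - d p.2)).le
      ((villainKernel_pos hκ 0).le.trans (hMκ 0))
  · have h := tendsto_villainEdgeTrunc hκ hκκ' hT (Tlim := fun x => 2 * Real.cosh x)
      (fun x => (tendsto_coshTrunc x).const_mul 2) (d p.1) (d p.2)
    rwa [(hasSum_villainEdge_cosh hκ hκκ' (d p.1) (d p.2)).tsum_eq] at h


/-! ### Bounded limits of positive kernels: closure properties and the edge induction -/

section LimPosKernel

variable {X : Type*} [TopologicalSpace X]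

/-- A bounded positive kernel is (trivially) a bounded limit of positive kernels. [folklore] -/
theorem exists_isPosKernel_tendsto_of_isPosKernel {K : X × X → ℝ} (hK : IsPosKernel K) {M : ℝ}
    (hM : ∀ p, |K p| ≤ M) :
    ∃ (k : ℕ → X × X → ℝ) (M : ℝ), (∀ N, IsPosKernel (k N)) ∧ (∀ N p, |k N p| ≤ M) ∧
      ∀ p, Tendsto (fun N => k N p) atTop (𝓝 (K p)) :=
  ⟨fun _ => K, M, fun _ => hK, fun _ p => hM p, fun _ => tendsto_const_nhds⟩

/-- A non-negative constant is a bounded limit of positive kernels. [folklore] -/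
theorem exists_isPosKernel_tendsto_const {a : ℝ} (ha : 0 ≤ a) :
    ∃ (k : ℕ → X × X → ℝ) (M : ℝ), (∀ N, IsPosKernel (k N)) ∧ (∀ N p, |k N p| ≤ M) ∧
      ∀ p, Tendsto (fun N => k N p) atTop (𝓝 a) :=
  exists_isPosKernel_tendsto_of_isPosKernel (isPosKernel_const ha) (M := a) fun _ => by
    rw [abs_of_nonneg ha]

/-- Bounded limits of positive kernels are closed under addition. [folklore] -/
theorem exists_isPosKernel_tendsto_add {K K' : X × X → ℝ}
    (h : ∃ (k : ℕ → X × X → ℝ) (M : ℝ), (∀ N, IsPosKernel (k N)) ∧ (∀ N p, |k N p| ≤ M) ∧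
      ∀ p, Tendsto (fun N => k N p) atTop (𝓝 (K p)))
    (h' : ∃ (k : ℕ → X × X → ℝ) (M : ℝ), (∀ N, IsPosKernel (k N)) ∧ (∀ N p, |k N p| ≤ M) ∧
      ∀ p, Tendsto (fun N => k N p) atTop (𝓝 (K' p))) :
    ∃ (k : ℕ → X × X → ℝ) (M : ℝ), (∀ N, IsPosKernel (k N)) ∧ (∀ N p, |k N p| ≤ M) ∧
      ∀ p, Tendsto (fun N => k N p) atTop (𝓝 (K p + K' p)) := by
  obtain ⟨k, M, hk, hM, hlim⟩ := h
  obtain ⟨k', M', hk', hM', hlim'⟩ := h'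
  refine ⟨fun N => k N + k' N, M + M', fun N => (hk N).add (hk' N), fun N p => ?_,
    fun p => (hlim p).add (hlim' p)⟩
  exact (abs_add_le _ _).trans (add_le_add (hM N p) (hM' N p))

/-- Bounded limits of positive kernels are closed under multiplication. [folklore] -/
theorem exists_isPosKernel_tendsto_mul {K K' : X × X → ℝ}
    (h : ∃ (k : ℕ → X × X → ℝ) (M : ℝ), (∀ N, IsPosKernel (k N)) ∧ (∀ N p, |k N p| ≤ M) ∧
      ∀ p, Tendsto (fun N => k N p) atTop (𝓝 (K p)))
    (h' : ∃ (k : ℕ → X × X → ℝ) (M : ℝ), (∀ N, IsPosKernel (k N)) ∧ (∀ N p, |k N p| ≤ M) ∧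
      ∀ p, Tendsto (fun N => k N p) atTop (𝓝 (K' p))) :
    ∃ (k : ℕ → X × X → ℝ) (M : ℝ), (∀ N, IsPosKernel (k N)) ∧ (∀ N p, |k N p| ≤ M) ∧
      ∀ p, Tendsto (fun N => k N p) atTop (𝓝 (K p * K' p)) := by
  obtain ⟨k, M, hk, hM, hlim⟩ := h
  obtain ⟨k', M', hk', hM', hlim'⟩ := h'
  refine ⟨fun N => k N * k' N, M * M', fun N => (hk N).mul (hk' N), fun N p => ?_,
    fun p => (hlim p).mul (hlim' p)⟩
  change |k N p * k' N p| ≤ M * M'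
  rw [abs_mul]
  exact mul_le_mul (hM N p) (hM' N p) (abs_nonneg _) ((abs_nonneg _).trans (hM N p))

/-- Bounded limits of positive kernels are closed under non-negative scalars. [folklore] -/
theorem exists_isPosKernel_tendsto_const_mul {K : X × X → ℝ} {a : ℝ} (ha : 0 ≤ a)
    (h : ∃ (k : ℕ → X × X → ℝ) (M : ℝ), (∀ N, IsPosKernel (k N)) ∧ (∀ N p, |k N p| ≤ M) ∧
      ∀ p, Tendsto (fun N => k N p) atTop (𝓝 (K p))) :
    ∃ (k : ℕ → X × X → ℝ) (M : ℝ), (∀ N, IsPosKernel (k N)) ∧ (∀ N p, |k N p| ≤ M) ∧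
      ∀ p, Tendsto (fun N => k N p) atTop (𝓝 (a * K p)) :=
  exists_isPosKernel_tendsto_mul (exists_isPosKernel_tendsto_const ha) h

/-- **The edge induction.** If for every edge `e` both `B_e − A_e` and `A_e + B_e` are bounded
limits of positive kernels, then so are `∏_e B_e − ∏_e A_e` and `∏_e B_e + ∏_e A_e`:
`B Y − A X = ½[(B − A)(Y + X) + (A + B)(Y − X)]`, `B Y + A X = ½[(A + B)(Y + X) + (B − A)(Y − X)]`.
[folklore] -/
theorem exists_isPosKernel_tendsto_prod_sub_prod {ι : Type*} (s : Finset ι)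
    {A B : ι → X × X → ℝ}
    (hsub : ∀ e ∈ s, ∃ (k : ℕ → X × X → ℝ) (M : ℝ), (∀ N, IsPosKernel (k N)) ∧
      (∀ N p, |k N p| ≤ M) ∧ ∀ p, Tendsto (fun N => k N p) atTop (𝓝 (B e p - A e p)))
    (hadd : ∀ e ∈ s, ∃ (k : ℕ → X × X → ℝ) (M : ℝ), (∀ N, IsPosKernel (k N)) ∧
      (∀ N p, |k N p| ≤ M) ∧ ∀ p, Tendsto (fun N => k N p) atTop (𝓝 (A e p + B e p))) :
    (∃ (k : ℕ → X × X → ℝ) (M : ℝ), (∀ N, IsPosKernel (k N)) ∧ (∀ N p, |k N p| ≤ M) ∧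
      ∀ p, Tendsto (fun N => k N p) atTop (𝓝 (∏ e ∈ s, B e p - ∏ e ∈ s, A e p))) ∧
    (∃ (k : ℕ → X × X → ℝ) (M : ℝ), (∀ N, IsPosKernel (k N)) ∧ (∀ N p, |k N p| ≤ M) ∧
      ∀ p, Tendsto (fun N => k N p) atTop (𝓝 (∏ e ∈ s, B e p + ∏ e ∈ s, A e p))) := by
  classical
  induction s using Finset.induction_on with
  | empty =>
    simp only [Finset.prod_empty, sub_self, one_add_one_eq_two]
    exact ⟨exists_isPosKernel_tendsto_const le_rfl, exists_isPosKernel_tendsto_const zero_le_two⟩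
  | insert e s hes ih =>
    obtain ⟨ih1, ih2⟩ := ih (fun e' he' => hsub e' (Finset.mem_insert_of_mem he'))
      (fun e' he' => hadd e' (Finset.mem_insert_of_mem he'))
    have h1 := hsub e (Finset.mem_insert_self e s)
    have h2 := hadd e (Finset.mem_insert_self e s)
    simp only [Finset.prod_insert hes]
    constructor
    · have key : ∀ p, B e p * ∏ e ∈ s, B e p - A e p * ∏ e ∈ s, A e p =
          (1 / 2 : ℝ) * ((B e p - A e p) * (∏ e ∈ s, B e p + ∏ e ∈ s, A e p) +
            (A e p + B e p) * (∏ e ∈ s, B e p - ∏ e ∈ s, A e p)) := fun p => by ring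
      simp only [key]
      exact exists_isPosKernel_tendsto_const_mul (by norm_num)
        (exists_isPosKernel_tendsto_add (exists_isPosKernel_tendsto_mul h1 ih2)
          (exists_isPosKernel_tendsto_mul h2 ih1))
    · have key : ∀ p, B e p * ∏ e ∈ s, B e p + A e p * ∏ e ∈ s, A e p =
          (1 / 2 : ℝ) * ((A e p + B e p) * (∏ e ∈ s, B e p + ∏ e ∈ s, A e p) +
            (B e p - A e p) * (∏ e ∈ s, B e p - ∏ e ∈ s, A e p)) := fun p => by ring
      simp only [key]
      exact exists_isPosKernel_tendsto_const_mul (by norm_num)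
        (exists_isPosKernel_tendsto_add (exists_isPosKernel_tendsto_mul h2 ih2)
          (exists_isPosKernel_tendsto_mul h1 ih1))

/-- **Positivity of bounded limits of positive kernels** (dominated convergence and
`∫∫ ∑ᵢ cᵢ Gᵢ(x)Gᵢ(y) = ∑ᵢ cᵢ (∫ Gᵢ)² ≥ 0`), for a finite measure integrating every continuous
function (e.g. a finite measure carried by a bounded subset of `ℝ^V`). [folklore] -/
theorem integral_nonneg_of_exists_isPosKernel_tendsto [SecondCountableTopology X]
    [MeasurableSpace X] [OpensMeasurableSpace X] (ν : Measure X) [IsFiniteMeasure ν]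
    (hint : ∀ g : X → ℝ, Continuous g → Integrable g ν) {K : X × X → ℝ}
    (h : ∃ (k : ℕ → X × X → ℝ) (M : ℝ), (∀ N, IsPosKernel (k N)) ∧ (∀ N p, |k N p| ≤ M) ∧
      ∀ p, Tendsto (fun N => k N p) atTop (𝓝 (K p))) :
    0 ≤ ∫ p, K p ∂(ν.prod ν) := by
  obtain ⟨k, M, hk, hM, hlim⟩ := h
  have hlim' : Tendsto (fun N => ∫ p, k N p ∂(ν.prod ν)) atTop (𝓝 (∫ p, K p ∂(ν.prod ν))) := by
    refine tendsto_integral_of_dominated_convergence (fun _ => M) (fun N => ?_)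
      (integrable_const M) (fun N => ae_of_all _ fun p => ?_) (ae_of_all _ fun p => hlim p)
    · exact (hk N).continuous.aestronglyMeasurable
    · rw [Real.norm_eq_abs]; exact hM N p
  refine ge_of_tendsto' hlim' fun N => ?_
  obtain ⟨K', _, c, G, hc, hG, hkN⟩ := hk N
  rw [hkN]
  have hi : ∀ i, Integrable (fun p : X × X => c i * (G i p.1 * G i p.2)) (ν.prod ν) := fun i =>
    ((hint _ (hG i)).mul_prod (hint _ (hG i))).const_mul (c i)
  simp only
  rw [integral_finsetSum _ fun i _ => hi i]
  refine Finset.sum_nonneg fun i _ => ?_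
  rw [integral_const_mul, integral_prod_mul]
  exact mul_nonneg (hc i) (mul_self_nonneg _)

end LimPosKernel


/-! ### Ginibre's duplicated-variables frame on a compact abelian group -/

section Frame

variable {Ω : Type*} [CommGroup Ω] [TopologicalSpace Ω] [IsTopologicalGroup Ω] [CompactSpace Ω]
  [SecondCountableTopology Ω] [MeasurableSpace Ω] [BorelSpace Ω]

/-- **Monotonicity from positivity of the duplicated integral** (Ginibre's frame, for two
arbitrary continuous weights `W, W' > 0` instead of `W' = W e^{K}`): if
`∫∫ (f(φψ) − f(φψ⁻¹)) (W'(φψ) W(φψ⁻¹) − W(φψ) W'(φψ⁻¹)) dμ(φ) dμ(ψ) ≥ 0` for a Haar measure `μ` on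
a compact abelian group in which every element is a square, then
`(∫ f W)(∫ W') ≤ (∫ f W')(∫ W)`, i.e. `⟨f⟩_W ≤ ⟨f⟩_{W'}` — by the duplicated-system expansion
`integral_sub_mul_sub_mul` and the change of variables `integral_comp_dupHom`.
[cite: Ginibre1970, main theorem with the plane-rotator example cos(m·φ)] -/
theorem integral_mul_integral_le_of_dup_nonneg (μ : Measure Ω) [μ.IsHaarMeasure]
    [IsFiniteMeasure μ] (h2 : Function.Surjective fun ψ : Ω => ψ * ψ) {f W W' : Ω → ℝ}
    (hf : Continuous f) (hW : Continuous W) (hW' : Continuous W') (hW0 : ∀ θ, W θ ≠ 0)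
    (hpos : 0 ≤ ∫ p : Ω × Ω, (f (p.1 * p.2) - f (p.1 * p.2⁻¹)) *
      (W' (p.1 * p.2) * W (p.1 * p.2⁻¹) - W (p.1 * p.2) * W' (p.1 * p.2⁻¹)) ∂(μ.prod μ)) :
    (∫ θ, f θ * W θ ∂μ) * (∫ θ, W' θ ∂μ) ≤ (∫ θ, f θ * W' θ ∂μ) * (∫ θ, W θ ∂μ) := by
  have hu : Continuous fun θ => W' θ / W θ := hW'.div hW hW0
  have hdup := integral_sub_mul_sub_mul μ hf hu hW
  have hWu : ∀ θ, W θ * (W' θ / W θ) = W' θ := fun θ => by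
    have := hW0 θ; field_simp
  have hpt : ∀ p : Ω × Ω, (f p.1 - f p.2) * (W' p.1 / W p.1 - W' p.2 / W p.2) * (W p.1 * W p.2) =
      (f p.1 - f p.2) * (W' p.1 * W p.2 - W p.1 * W' p.2) := fun p => by
    have h1 := hW0 p.1
    have h2 := hW0 p.2
    field_simp
  simp only [hWu, hpt] at hdup
  have hF : Continuous fun p : Ω × Ω =>
      (f p.1 - f p.2) * (W' p.1 * W p.2 - W p.1 * W' p.2) := by fun_prop
  have hcv := integral_comp_dupHom μ h2 hF
  simp only [dupHom_apply] at hcv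
  rw [hcv, hdup] at hpos
  nlinarith [hpos]

end Frame

/-! ### The Villain model on the torus `U(1)^V` and the proof of Corollary 11.4 -/

section Assembly

/-- Every element of `U(1)^V` is a square (`e^{i arg/2}` coordinatewise). [folklore] -/
theorem exists_mul_self_circlePi {V : Type*} (θ : V → Circle) : ∃ ψ : V → Circle, ψ * ψ = θ := by
  refine ⟨fun v => Circle.exp (Complex.arg (θ v : ℂ) / 2), funext fun v => ?_⟩
  rw [Pi.mul_apply, ← Circle.exp_add, add_halves, Circle.exp_arg]

/-- **Aizenman–Harel–Peled–Shapiro 2021, Corollary 11.4 (Ginibre monotonicity of the Villain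
two-point function), proved.** The printed proof combines the `XY` Ginibre inequality with the
metric-graph limit Thm 11.2 (a local central limit theorem for the `N`-fold subdivided `XY`
chain); here we give instead a direct duplicated-variables (Ginibre) argument for the Villain
weights themselves: after `θ = φψ`, `θ' = φψ⁻¹` on the torus `U(1)^V`, every edge factor
`φ_κ(a+b)φ_κ'(a−b) ∓ φ_κ'(a+b)φ_κ(a−b)` is, by re-indexing the product of the two theta series
(`hasSum_villainEdge_sinh/cosh`), a Gaussian–`sinh`/`cosh` double series with non-negative
coefficients, hence a bounded limit of positive kernels; products and the observable
`cos(a+b) − cos(a−b) = −2 sin a sin b` preserve this, so the duplicated integral is `≥ 0`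
(dominated convergence on the angle cube), and Ginibre's frame
(`integral_mul_integral_le_of_dup_nonneg`) gives `⟨cos(θ_x − θ_y)⟩_κ ≤ ⟨cos(θ_x − θ_y)⟩_{κ'}`.
The simple-graph hypotheses of the vendored statement are not used.
[cite: AizenmanHarelPeledShapiro2021, Cor. 11.4 (with Thm 11.2 and §11, first paragraph)] -/
theorem AizenmanHarelPeledShapiro2021_villainTwoPoint_mono_holds :
    AizenmanHarelPeledShapiro2021_villainTwoPoint_mono := by
  intro V ι _ _ s t _ _ κ κ' hκ hκκ' x y
  have hκ' : ∀ e, 0 < κ' e := fun e => (hκ e).trans_le (hκκ' e)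
  haveI : (haarProbability Circle).IsHaarMeasure := by
    unfold haarProbability; infer_instance
  -- the torus `U(1)^V`, its Haar probability measure, and the model transported to it
  set μ : Measure (V → Circle) := Measure.pi fun _ => haarProbability Circle with hμdef
  set E : (V → ℝ) → (V → Circle) := fun θ v => Circle.exp (θ v) with hEdef
  set Wt : (ι → ℝ) → (V → Circle) → ℝ := fun k u =>
    ∏ e, villainKernel (k e) (Complex.arg ((u (t e) / u (s e) : Circle) : ℂ)) with hWtdef
  set ft : (V → Circle) → ℝ := fun u => ((u x / u y : Circle) : ℂ).re with hftdef
  have hWc : ∀ k : ι → ℝ, (∀ e, 0 < k e) → Continuous (Wt k) := fun k hk =>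
    continuous_finsetProd _ fun e _ => (continuous_villainKernel_arg (hk e)).comp
      ((continuous_apply (t e)).div' (continuous_apply (s e)))
  have hWpos : ∀ k : ι → ℝ, (∀ e, 0 < k e) → ∀ u, 0 < Wt k u := fun k hk u =>
    Finset.prod_pos fun e _ => villainKernel_pos (hk e) _
  have hfc : Continuous ft := Complex.continuous_re.comp
    (continuous_subtype_val.comp ((continuous_apply x).div' (continuous_apply y)))
  -- pull-backs along `θ ↦ (e^{iθ_v})_v`
  have harg : ∀ β r : ℝ, villainKernel β (Complex.arg (Circle.exp r : ℂ)) = villainKernel β r :=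
    fun β r => by
    rw [Circle.coe_exp, Complex.arg_exp_mul_I, toIocMod]
    exact (show Function.Periodic (villainKernel β) (2 * Real.pi) from
      villainKernel_add_two_pi β).sub_zsmul_eq _
  have hWE : ∀ (k : ι → ℝ) (θ : V → ℝ), Wt k (E θ) = villainSpinWeight s t k θ := fun k θ => by
    simp only [hWtdef, hEdef, villainSpinWeight]
    refine Finset.prod_congr rfl fun e _ => ?_
    rw [← Circle.exp_sub, harg]
  have hfE : ∀ θ : V → ℝ, ft (E θ) = Real.cos (θ x - θ y) := fun θ => by
    simp only [hftdef, hEdef]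
    rw [← Circle.exp_sub, Circle.coe_exp, Complex.exp_ofReal_mul_I_re]
  -- Haar integrals over `U(1)^V` are angle integrals over the cube `[-π, π)^V`
  have htr : ∀ G : (V → Circle) → ℝ, Continuous G →
      ∫ u, G u ∂μ = ((2 * Real.pi)⁻¹) ^ Fintype.card V * ∫ θ in angleCube V, G (E θ) :=
    fun G hG => by
    rw [hμdef, CircleHaar.integral_pi_haarProbability_circle G hG.aestronglyMeasurable,
      CircleHaar.setIntegral_pi_Ioc_eq_pi_Ico, smul_eq_mul]
    rfl
  have hc : (0 : ℝ) < ((2 * Real.pi)⁻¹) ^ Fintype.card V := by positivity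
  have htp : ∀ k : ι → ℝ, (∀ e, 0 < k e) →
      villainTwoPoint s t k x y = (∫ u, ft u * Wt k u ∂μ) / ∫ u, Wt k u ∂μ := fun k hk => by
    rw [htr (fun u => ft u * Wt k u) (hfc.mul (hWc k hk)), htr _ (hWc k hk),
      mul_div_mul_left _ _ hc.ne']
    simp only [hWE, hfE]
    rfl
  have hZ : ∀ k : ι → ℝ, (∀ e, 0 < k e) → 0 < ∫ u, Wt k u ∂μ := fun k hk =>
    (hWc k hk).integral_pos_of_hasCompactSupport_nonneg_nonzero
      (HasCompactSupport.of_compactSpace _) (fun u => (hWpos k hk u).le) (hWpos k hk 1).ne'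
  rw [htp κ hκ, htp κ' hκ', div_le_div_iff₀ (hZ κ hκ) (hZ κ' hκ')]
  refine integral_mul_integral_le_of_dup_nonneg μ exists_mul_self_circlePi hfc (hWc κ hκ)
    (hWc κ' hκ') (fun u => (hWpos κ hκ u).ne') ?_
  -- ## positivity of the duplicated integral: pull it back to the angle cube
  set G : (V → Circle) × (V → Circle) → ℝ := fun p =>
    (ft (p.1 * p.2) - ft (p.1 * p.2⁻¹)) *
      (Wt κ' (p.1 * p.2) * Wt κ (p.1 * p.2⁻¹) - Wt κ (p.1 * p.2) * Wt κ' (p.1 * p.2⁻¹)) with hGdef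
  have hGc : Continuous G := by
    have h1 := hWc κ hκ
    have h2 := hWc κ' hκ'
    rw [hGdef]
    fun_prop
  set νa : Measure (V → ℝ) := Measure.pi fun _ : V => CircleHaar.angleMeasure with hνadef
  have hmp : MeasurePreserving (Prod.map E E) (νa.prod νa) (μ.prod μ) :=
    CircleHaar.measurePreserving_exp_pi.prod CircleHaar.measurePreserving_exp_pi
  rw [← hmp.map_eq, integral_map hmp.measurable.aemeasurable hGc.aestronglyMeasurable]
  -- the pulled-back integrand
  have hEmul : ∀ α β : V → ℝ, E α * E β = E (α + β) := fun α β => funext fun v => by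
    simp only [hEdef, Pi.mul_apply, Pi.add_apply, Circle.exp_add]
  have hEdiv : ∀ α β : V → ℝ, E α * (E β)⁻¹ = E (α - β) := fun α β => funext fun v => by
    simp only [hEdef, Pi.mul_apply, Pi.inv_apply, Pi.sub_apply, Circle.exp_sub, div_eq_mul_inv]
  have hΦ : ∀ q : (V → ℝ) × (V → ℝ), G (Prod.map E E q) =
      2 * (Real.sin (q.1 x - q.1 y) * Real.sin (q.2 x - q.2 y)) *
        (∏ e, villainKernel (κ e) (q.1 (t e) - q.1 (s e) + (q.2 (t e) - q.2 (s e))) *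
            villainKernel (κ' e) (q.1 (t e) - q.1 (s e) - (q.2 (t e) - q.2 (s e))) -
          ∏ e, villainKernel (κ' e) (q.1 (t e) - q.1 (s e) + (q.2 (t e) - q.2 (s e))) *
            villainKernel (κ e) (q.1 (t e) - q.1 (s e) - (q.2 (t e) - q.2 (s e)))) := by
    rintro ⟨α, β⟩
    simp only [hGdef, Prod.map_apply]
    rw [hEmul, hEdiv, hWE, hWE, hWE, hWE, hfE, hfE]
    simp only [villainSpinWeight, Pi.add_apply, Pi.sub_apply]
    rw [show α x + β x - (α y + β y) = (α x - α y) + (β x - β y) by ring,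
      show α x - β x - (α y - β y) = (α x - α y) - (β x - β y) by ring,
      Real.cos_add (α x - α y) (β x - β y), Real.cos_sub (α x - α y) (β x - β y),
      ← Finset.prod_mul_distrib, ← Finset.prod_mul_distrib]
    have h1 : ∀ e, α (t e) + β (t e) - (α (s e) + β (s e)) =
        α (t e) - α (s e) + (β (t e) - β (s e)) := fun e => by ring
    have h2 : ∀ e, α (t e) - β (t e) - (α (s e) - β (s e)) =
        α (t e) - α (s e) - (β (t e) - β (s e)) := fun e => by ring
    simp only [h1, h2]
    ring
  rw [integral_congr_ae (ae_of_all _ hΦ)]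
  -- continuous functions are integrable for the (compactly supported) angle measure
  have hint : ∀ g : (V → ℝ) → ℝ, Continuous g → Integrable g νa := fun g hg => by
    rw [hνadef, CircleHaar.pi_angleMeasure]
    refine Integrable.smul_measure ?_
      (ENNReal.pow_ne_top (ENNReal.inv_ne_top.2 CircleHaar.ofReal_two_pi_ne_zero))
    refine (hg.continuousOn.integrableOn_compact
      (isCompact_Icc (a := fun _ : V => -Real.pi) (b := fun _ => Real.pi))).mono_set ?_
    rw [← Set.pi_univ_Icc]
    exact Set.pi_mono fun _ _ => Set.Ioc_subset_Icc_self
  refine integral_nonneg_of_exists_isPosKernel_tendsto νa hint ?_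
  -- the integrand is a bounded limit of positive kernels
  have hsin : IsPosKernel (fun p : (V → ℝ) × (V → ℝ) =>
      2 * (Real.sin (p.1 x - p.1 y) * Real.sin (p.2 x - p.2 y))) :=
    (isPosKernel_mul_self (by fun_prop : Continuous fun θ : V → ℝ => Real.sin (θ x - θ y))).const_mul
      zero_le_two
  have hsinb : ∀ p : (V → ℝ) × (V → ℝ),
      |2 * (Real.sin (p.1 x - p.1 y) * Real.sin (p.2 x - p.2 y))| ≤ 2 := fun p => by
    rw [abs_mul, abs_mul, abs_two]
    have := Real.abs_sin_le_one (p.1 x - p.1 y)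
    have := Real.abs_sin_le_one (p.2 x - p.2 y)
    nlinarith [abs_nonneg (Real.sin (p.1 x - p.1 y)), abs_nonneg (Real.sin (p.2 x - p.2 y))]
  have hedges := exists_isPosKernel_tendsto_prod_sub_prod (X := V → ℝ) (Finset.univ : Finset ι)
    (A := fun e p => villainKernel (κ' e) (p.1 (t e) - p.1 (s e) + (p.2 (t e) - p.2 (s e))) *
      villainKernel (κ e) (p.1 (t e) - p.1 (s e) - (p.2 (t e) - p.2 (s e))))
    (B := fun e p => villainKernel (κ e) (p.1 (t e) - p.1 (s e) + (p.2 (t e) - p.2 (s e))) *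
      villainKernel (κ' e) (p.1 (t e) - p.1 (s e) - (p.2 (t e) - p.2 (s e))))
    (fun e _ => exists_isPosKernel_tendsto_villainEdge_sub (X := V → ℝ)
      (d := fun θ : V → ℝ => θ (t e) - θ (s e)) (by fun_prop) (hκ e) (hκκ' e))
    (fun e _ => exists_isPosKernel_tendsto_villainEdge_add (X := V → ℝ)
      (d := fun θ : V → ℝ => θ (t e) - θ (s e)) (by fun_prop) (hκ e) (hκκ' e))
  exact exists_isPosKernel_tendsto_mul (exists_isPosKernel_tendsto_of_isPosKernel hsin hsinb)
    hedges.1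

end Assembly

end Literature.Probability.LatticeModels
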